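import Summits.CriticalPhenomena.SAWScalingLimit.Theorems.SAWLoopFugacityFlowAvoidancePassageCrosscutSides

/-!
# Excursions of the boundary of a subdomain, and the bites they cut off

Support file for item `stmt-CriticalPhenomena-4984` (`AvoidancePassage`). For Jordan domains
`D' ⊆ D` (carriers) such that at least two points of `∂D'` lie outside `D`:

* `exists_excursion` — every parameter `u` with `D'.boundary u ∈ D` lies in a maximal open
  parameter interval `(u₀, u₁) ∋ u`, of length `< 1`, mapped into `D`, with
  `D'.boundary u₀, D'.boundary u₁ ∉ D` (an **excursion** of `∂D'` inside `D`);
* `exists_bite` — the excursion arc `e = D'.boundary '' [u₀, u₁]` is a cross-cut of `D`; by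
  Newman's theorem (`exists_sides`, `…CrosscutSides`) `D ∖ e = B ⊔ W` with `D' ⊆ W`; the **bite**
  `B` is a Jordan domain with `∂B = e ∪ s`, `s ⊆ ∂D` the **shadow** arc, boundary loop through `s`
  on `[0, ½]` and `e` on `[½, 1]`;
* `not_mem_closure_of_mem_shadow`, `eq_or_disjoint_of_sides` — the open shadow misses `cl D'`;
  two bites are equal or disjoint.

All folklore plane topology; no new definitions.
-/

noncomputable section

namespace Summit.CriticalPhenomena.SAWScalingLimit.Theorems.AvoidancePassage

open Set Metric Filter Topology
open Literature.Topology.PlaneTopology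
open Literature.Probability.RandomPlanarGeometry (JordanDomain)

/-! ### Excursions -/

/-- **Excursions.** If `D'.boundary u ∈ D` and two distinct points of `∂D'` lie outside `D`, then
`u` lies in an open parameter interval `(u₀, u₁)` of length `< 1` which `D'.boundary` maps into
`D`, while `D'.boundary u₀, D'.boundary u₁ ∉ D` (the connected component of `u` in the open set
`{t | D'.boundary t ∈ D}`). [folklore] -/
theorem exists_excursion (D D' : JordanDomain) {u : ℝ} (hu : D'.boundary u ∈ D.carrier)
    {p₁ p₂ : ℂ} (hp₁ : p₁ ∈ frontier D'.carrier) (hp₂ : p₂ ∈ frontier D'.carrier) (hp : p₁ ≠ p₂)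
    (hp₁D : p₁ ∉ D.carrier) (hp₂D : p₂ ∉ D.carrier) :
    ∃ u₀ u₁ : ℝ, u₀ < u ∧ u < u₁ ∧ u₁ < u₀ + 1 ∧ (∀ t ∈ Ioo u₀ u₁, D'.boundary t ∈ D.carrier) ∧
      D'.boundary u₀ ∉ D.carrier ∧ D'.boundary u₁ ∉ D.carrier := by
  set S : Set ℝ := {t | D'.boundary t ∈ D.carrier} with hS
  have hSo : IsOpen S := D.isOpen.preimage D'.continuous_boundary
  have huS : u ∈ S := hu
  set I := connectedComponentIn S u with hI
  have hIo : IsOpen I := hSo.connectedComponentIn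
  have hIS : I ⊆ S := connectedComponentIn_subset _ _
  have huI : u ∈ I := mem_connectedComponentIn huS
  have hIc : IsPreconnected I := isPreconnected_connectedComponentIn
  -- a parameter of `p₁` just below `u`
  rw [← D'.range_boundary] at hp₁ hp₂
  obtain ⟨v, rfl⟩ := hp₁
  obtain ⟨v₂, rfl⟩ := hp₂
  obtain ⟨y, hy, hyv⟩ := D'.periodic_boundary.exists_mem_Ico one_pos v (u - 1)
  have hyS : y ∉ S := fun h ↦ hp₁D (by rw [hyv]; exact h)
  have hy1S : y + 1 ∉ S := fun h ↦ hp₁D (by rw [hyv, ← D'.periodic_boundary y]; exact h)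
  have hyu : y < u := lt_of_le_of_ne (by linarith [hy.2]) fun h ↦ hyS (h ▸ huS)
  have huy : u < y + 1 := lt_of_le_of_ne (by linarith [hy.1]) fun h ↦ hy1S (h ▸ huS)
  have hIsub : I ⊆ Ioo y (y + 1) := by
    intro w hw
    constructor
    · by_contra h
      exact hyS (hIS (hIc.Icc_subset hw huI ⟨not_lt.1 h, hyu.le⟩))
    · by_contra h
      exact hy1S (hIS (hIc.Icc_subset huI hw ⟨huy.le, not_lt.1 h⟩))
  have hbdd : BddBelow I := ⟨y, fun w hw ↦ (hIsub hw).1.le⟩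
  have hbda : BddAbove I := ⟨y + 1, fun w hw ↦ (hIsub hw).2.le⟩
  have hne : I.Nonempty := ⟨u, huI⟩
  have hIcc : I ⊆ Icc (sInf I) (sSup I) := subset_Icc_csInf_csSup hbdd hbda
  have hIoo : Ioo (sInf I) (sSup I) ⊆ I := IsConnected.Ioo_csInf_csSup_subset ⟨hne, hIc⟩ hbdd hbda
  have hy₀ : y ≤ sInf I := le_csInf hne fun w hw ↦ (hIsub hw).1.le
  have hy₁ : sSup I ≤ y + 1 := csSup_le hne fun w hw ↦ (hIsub hw).2.le
  -- the end-points are not in `I` (open)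
  have h₀I : sInf I ∉ I := by
    intro h
    obtain ⟨ε, hε, hball⟩ := Metric.isOpen_iff.1 hIo _ h
    have hm : sInf I - ε / 2 ∈ I := hball (by
      rw [mem_ball, Real.dist_eq, show sInf I - ε / 2 - sInf I = -(ε / 2) by ring, abs_neg,
        abs_of_pos (by positivity)]; linarith)
    have := (hIcc hm).1
    linarith
  have h₁I : sSup I ∉ I := by
    intro h
    obtain ⟨ε, hε, hball⟩ := Metric.isOpen_iff.1 hIo _ h
    have hm : sSup I + ε / 2 ∈ I := hball (by
      rw [mem_ball, Real.dist_eq, show sSup I + ε / 2 - sSup I = ε / 2 by ring,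
        abs_of_pos (by positivity)]; linarith)
    have := (hIcc hm).2
    linarith
  have hu₀ : sInf I < u := lt_of_le_of_ne (hIcc huI).1 fun h ↦ h₀I (h ▸ huI)
  have hu₁ : u < sSup I := lt_of_le_of_ne (hIcc huI).2 fun h ↦ h₁I (h.symm ▸ huI)
  -- the end-points are not in `S` (maximality of the component)
  have key : ∀ w, w ∈ S → ∀ ε > 0, ball w ε ⊆ S → (∃ x ∈ I, x ∈ ball w ε) → ball w ε ⊆ I := by
    intro w _ ε _ hεS ⟨x, hxI, hxb⟩
    have hpre : IsPreconnected (I ∪ ball w ε) :=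
      IsPreconnected.union x hxI hxb hIc (convex_ball w ε).isPreconnected
    have hsub : I ∪ ball w ε ⊆ I :=
      hpre.subset_connectedComponentIn (Or.inl huI) (union_subset hIS hεS)
    exact subset_union_right.trans hsub
  have h₀S : sInf I ∉ S := by
    intro h
    obtain ⟨ε, hε, hball⟩ := Metric.isOpen_iff.1 hSo _ h
    set δ := min (ε / 2) ((u - sInf I) / 2) with hδ
    have hδpos : 0 < δ := lt_min (by positivity) (by linarith)
    have hδε : δ ≤ ε / 2 := min_le_left _ _
    have hδu : δ ≤ (u - sInf I) / 2 := min_le_right _ _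
    have hx : sInf I + δ ∈ I := hIoo ⟨by linarith, by linarith⟩
    have hxb : sInf I + δ ∈ ball (sInf I) ε := by
      rw [mem_ball, Real.dist_eq, show sInf I + δ - sInf I = δ by ring, abs_of_pos hδpos]; linarith
    have hsub := key _ h ε hε hball ⟨_, hx, hxb⟩
    have hm : sInf I - ε / 2 ∈ I := hsub (by
      rw [mem_ball, Real.dist_eq, show sInf I - ε / 2 - sInf I = -(ε / 2) by ring, abs_neg,
        abs_of_pos (by positivity)]; linarith)
    have := (hIcc hm).1
    linarith
  have h₁S : sSup I ∉ S := by
    intro h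
    obtain ⟨ε, hε, hball⟩ := Metric.isOpen_iff.1 hSo _ h
    set δ := min (ε / 2) ((sSup I - u) / 2) with hδ
    have hδpos : 0 < δ := lt_min (by positivity) (by linarith)
    have hδε : δ ≤ ε / 2 := min_le_left _ _
    have hδu : δ ≤ (sSup I - u) / 2 := min_le_right _ _
    have hx : sSup I - δ ∈ I := hIoo ⟨by linarith, by linarith⟩
    have hxb : sSup I - δ ∈ ball (sSup I) ε := by
      rw [mem_ball, Real.dist_eq, show sSup I - δ - sSup I = -δ by ring, abs_neg, abs_of_pos hδpos]
      linarith
    have hsub := key _ h ε hε hball ⟨_, hx, hxb⟩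
    have hm : sSup I + ε / 2 ∈ I := hsub (by
      rw [mem_ball, Real.dist_eq, show sSup I + ε / 2 - sSup I = ε / 2 by ring,
        abs_of_pos (by positivity)]; linarith)
    have := (hIcc hm).2
    linarith
  -- the length is `< 1` (otherwise `p₁ = p₂`)
  have hlen : sSup I < sInf I + 1 := by
    rcases lt_or_eq_of_le (show sSup I ≤ sInf I + 1 by linarith) with h | h
    · exact h
    · exfalso
      have he₀ : sInf I = y := le_antisymm (by linarith) hy₀
      obtain ⟨y₂, hy₂, hy₂v⟩ := D'.periodic_boundary.exists_mem_Ico one_pos v₂ y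
      have hy₂S : y₂ ∉ S := fun h' ↦ hp₂D (by rw [hy₂v]; exact h')
      have hy₂y : y₂ = y := by
        by_contra hne'
        have hlt : y < y₂ := lt_of_le_of_ne hy₂.1 (Ne.symm hne')
        exact hy₂S (hIS (hIoo ⟨by rw [he₀]; exact hlt, by rw [h, he₀]; exact hy₂.2⟩))
      apply hp
      rw [hyv, hy₂v, hy₂y]
  exact ⟨sInf I, sSup I, hu₀, hu₁, hlen, fun t ht ↦ hIS (hIoo ht), h₀S, h₁S⟩

/-! ### The excursion arc is a cross-cut; the bite -/

section Bite

variable (D D' : JordanDomain) {u₀ u₁ : ℝ}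

/-- The end-points of an excursion are frontier points of `D`. [folklore] -/
theorem boundary_mem_frontier_of_not_mem (hsub : D'.carrier ⊆ D.carrier) {t : ℝ}
    (h : D'.boundary t ∉ D.carrier) : D'.boundary t ∈ frontier D.carrier := by
  rw [D.isOpen.frontier_eq]
  exact ⟨closure_mono hsub (frontier_subset_closure (D'.boundary_mem_frontier t)), h⟩

/-- The excursion arc minus its end-points lies in `D`. [folklore] -/
theorem image_Icc_diff_subset (h01 : u₀ < u₁) (hin : ∀ t ∈ Ioo u₀ u₁, D'.boundary t ∈ D.carrier) :
    D'.boundary '' Icc u₀ u₁ \ {D'.boundary u₀, D'.boundary u₁} ⊆ D.carrier := by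
  rintro z ⟨⟨t, ht, rfl⟩, hz⟩
  simp only [mem_insert_iff, mem_singleton_iff, not_or] at hz
  rcases ht.1.eq_or_lt with rfl | h0
  · exact absurd rfl hz.1
  rcases ht.2.eq_or_lt with rfl | h1
  · exact absurd rfl hz.2
  exact hin t ⟨h0, h1⟩

/-- The excursion arc lies on `∂D'`, hence misses `D'` and lies in `closure D'`. [folklore] -/
theorem image_Icc_subset_frontier : D'.boundary '' Icc u₀ u₁ ⊆ frontier D'.carrier := by
  rintro _ ⟨t, -, rfl⟩
  exact D'.boundary_mem_frontier t

/-- **The bite of an excursion.** For an excursion `(u₀, u₁)` of `∂D'` inside `D` (`D' ⊆ D`), the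
arc `e = D'.boundary '' [u₀, u₁]` is a cross-cut of `D` and `D ∖ e = B ⊔ W` with `D' ⊆ W`, where the
bite `B` is a Jordan domain with `∂B = e ∪ s` (`s ⊆ ∂D` the shadow arc, from `D'.boundary u₀` to
`D'.boundary u₁`), `∂W = e ∪ A`, `s ∪ A = ∂D`, `s ∩ A` = the two end-points, and the boundary loop
of `B` runs through `s` on `[0, ½]` and through `e` on `[½, 1]`.
[cite: Newman1939, Ch. V §11, Thms. 11·7 and 11·8, pp. 94–95] -/
theorem exists_bite (hsub : D'.carrier ⊆ D.carrier) (h01 : u₀ < u₁) (h1 : u₁ < u₀ + 1)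
    (hin : ∀ t ∈ Ioo u₀ u₁, D'.boundary t ∈ D.carrier) (h₀ : D'.boundary u₀ ∉ D.carrier)
    (h₁ : D'.boundary u₁ ∉ D.carrier) :
    ∃ (B : JordanDomain) (W s A : Set ℂ), IsOpen W ∧ IsConnected W ∧ Disjoint B.carrier W ∧
      B.carrier ∪ W = D.carrier \ D'.boundary '' Icc u₀ u₁ ∧ D'.carrier ⊆ W ∧
      frontier B.carrier = D'.boundary '' Icc u₀ u₁ ∪ s ∧
      frontier W = D'.boundary '' Icc u₀ u₁ ∪ A ∧
      IsSimpleArc s (D'.boundary u₀) (D'.boundary u₁) ∧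
      IsSimpleArc A (D'.boundary u₀) (D'.boundary u₁) ∧ s ∪ A = frontier D.carrier ∧
      s ∩ A = {D'.boundary u₀, D'.boundary u₁} ∧ B.boundary 0 = D'.boundary u₀ ∧
      B.boundary (1 / 2) = D'.boundary u₁ ∧ B.boundary '' Icc 0 (1 / 2) = s ∧
      B.boundary '' Icc (1 / 2) 1 = D'.boundary '' Icc u₀ u₁ := by
  set e := D'.boundary '' Icc u₀ u₁ with he_def
  have he : IsSimpleArc e (D'.boundary u₀) (D'.boundary u₁) := D'.isSimpleArc_image_boundary h01 h1
  have hq₀ := boundary_mem_frontier_of_not_mem D D' hsub h₀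
  have hq₁ := boundary_mem_frontier_of_not_mem D D' hsub h₁
  have heD := image_Icc_diff_subset D D' h01 hin
  have hD'sub : D'.carrier ⊆ D.carrier \ e := fun z hz ↦
    ⟨hsub hz, fun hze ↦ Set.disjoint_left.1 D'.disjoint_carrier_frontier hz
      (image_Icc_subset_frontier D' hze)⟩
  obtain ⟨Ub, Uw, Ab, Aw, hbo, hwo, hbc, hwc, hdisj, hunion, hfb, hfw, hAb, hAw, hAu, hAi, hD'⟩ :
      ∃ Ub Uw Ab Aw : Set ℂ, IsOpen Ub ∧ IsOpen Uw ∧ IsConnected Ub ∧ IsConnected Uw ∧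
        Disjoint Ub Uw ∧ Ub ∪ Uw = D.carrier \ e ∧ frontier Ub = e ∪ Ab ∧ frontier Uw = e ∪ Aw ∧
        IsSimpleArc Ab (D'.boundary u₀) (D'.boundary u₁) ∧
        IsSimpleArc Aw (D'.boundary u₀) (D'.boundary u₁) ∧ Ab ∪ Aw = frontier D.carrier ∧
        Ab ∩ Aw = {D'.boundary u₀, D'.boundary u₁} ∧ D'.carrier ⊆ Uw := by
    obtain ⟨U₁, U₂, A₁, A₂, h1o, h2o, h1c, h2c, hdisj, hunion, hf1, hf2, hA1, hA2, hAu, hAi⟩ :=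
      exists_sides D he hq₀ hq₁ heD
    rcases subset_or_subset_of_sides h1o h2o hdisj hunion D'.isConnected.isPreconnected hD'sub
      with h | h
    · exact ⟨U₂, U₁, A₂, A₁, h2o, h1o, h2c, h1c, hdisj.symm, by rw [union_comm, hunion], hf2, hf1,
        hA2, hA1, by rw [union_comm, hAu], by rw [inter_comm, hAi], h⟩
    · exact ⟨U₁, U₂, A₁, A₂, h1o, h2o, h1c, h2c, hdisj, hunion, hf1, hf2, hA1, hA2, hAu, hAi, h⟩
  have hAbF : Ab ⊆ frontier D.carrier := hAu ▸ subset_union_left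
  have hUbD : Ub ⊆ D.carrier := fun z hz ↦ ((hunion ▸ Or.inl hz : z ∈ D.carrier \ e)).1
  obtain ⟨B, hB, hB0, hBh, hBs, hBe⟩ :=
    exists_jordanDomain_of_frontier_eq D he hAb hAbF heD hbo hbc hUbD hfb
  subst hB
  exact ⟨B, Uw, Ab, Aw, hwo, hwc, hdisj, hunion, hD', hfb, hfw, hAb, hAw, hAu, hAi, hB0, hBh, hBs,
    hBe⟩

end Bite

/-! ### Elementary properties of bites -/

/-- A bite misses the closure of the inner domain. [folklore] -/
theorem disjoint_closure_of_subset_side {B W D' : Set ℂ} (hBo : IsOpen B) (hdisj : Disjoint B W)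
    (hD'W : D' ⊆ W) : Disjoint B (closure D') :=
  (hdisj.mono_right hD'W).closure_right hBo

/-- **The open shadow misses `cl D'`.** With `∂W = e ∪ A` (`W ⊆ D` the side containing `D'`),
`s ⊆ ∂D`, `e` meeting `∂D` only in `{q₀, q₁}` and `s ∩ A = {q₀, q₁}`: a point of `s` other than
`q₀, q₁` is not in `closure D'`. [folklore] -/
theorem not_mem_closure_of_mem_shadow (D : JordanDomain) {e s A W D' : Set ℂ} {q₀ q₁ z : ℂ}
    (hWD : W ⊆ D.carrier) (hfw : frontier W = e ∪ A) (hsF : s ⊆ frontier D.carrier)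
    (heD : e \ {q₀, q₁} ⊆ D.carrier) (hsA : s ∩ A = {q₀, q₁}) (hD'W : D' ⊆ W) (hz : z ∈ s)
    (hz₀ : z ≠ q₀) (hz₁ : z ≠ q₁) : z ∉ closure D' := by
  intro hzc
  have hzW : z ∈ closure W := closure_mono hD'W hzc
  rw [closure_eq_self_union_frontier, hfw] at hzW
  have hzF : z ∈ frontier D.carrier := hsF hz
  have hnot : z ∉ ({q₀, q₁} : Set ℂ) := by
    simp only [mem_insert_iff, mem_singleton_iff, not_or]; exact ⟨hz₀, hz₁⟩
  rcases hzW with hzW | hze | hzA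
  · exact Set.disjoint_left.1 D.disjoint_carrier_frontier (hWD hzW) hzF
  · exact hnot (inter_frontier_subset_pair D heD ⟨hze, hzF⟩)
  · exact hnot (hsA ▸ ⟨hz, hzA⟩)

/-- **Two bites are equal or disjoint.** If `B ⊔ W = D ∖ e` and `B' ⊔ W' = D ∖ e'` with
`e, e' ⊆ C` and `B, B'` preconnected, nonempty and disjoint from `C` (for bites: `C = cl D'`), then
`B = B'` or `B ∩ B' = ∅`. [folklore] -/
theorem eq_or_disjoint_of_sides {Dc e e' B W B' W' C : Set ℂ} (hBo : IsOpen B) (hWo : IsOpen W)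
    (hB'o : IsOpen B') (hW'o : IsOpen W') (hBc : IsPreconnected B) (hB'c : IsPreconnected B')
    (hB'ne : B'.Nonempty) (hd : Disjoint B W) (hd' : Disjoint B' W')
    (hu : B ∪ W = Dc \ e) (hu' : B' ∪ W' = Dc \ e') (he : e ⊆ C) (he' : e' ⊆ C)
    (hBC : Disjoint B C) (hB'C : Disjoint B' C) : B = B' ∨ Disjoint B B' := by
  have hB'sub : B' ⊆ Dc \ e := fun z hz ↦
    ⟨((hu' ▸ Or.inl hz : z ∈ Dc \ e')).1, fun hze ↦ Set.disjoint_left.1 hB'C hz (he hze)⟩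
  have hBsub : B ⊆ Dc \ e' := fun z hz ↦
    ⟨((hu ▸ Or.inl hz : z ∈ Dc \ e)).1, fun hze ↦ Set.disjoint_left.1 hBC hz (he' hze)⟩
  have h1 : B' ⊆ B ∨ B' ⊆ W := hB'c.subset_or_subset hBo hWo hd (hu.symm ▸ hB'sub)
  have h2 : B ⊆ B' ∨ B ⊆ W' := hBc.subset_or_subset hB'o hW'o hd' (hu'.symm ▸ hBsub)
  rcases h1 with h1 | h1
  · rcases h2 with h2 | h2
    · exact Or.inl (h2.antisymm h1)
    · obtain ⟨z, hz⟩ := hB'ne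
      exact absurd (h2 (h1 hz)) (Set.disjoint_left.1 hd' hz)
  · exact Or.inr (hd.mono_right h1)

end Summit.CriticalPhenomena.SAWScalingLimit.Theorems.AvoidancePassage

end
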